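import Literature.Analysis.OperatorTheory.PositivityImprovingSpectralGap
import HarnessLib

/-!
# Stub G `stub_gramContinuity`, tool 1: stability of the top eigenpair and of the gap of a
self-adjoint operator under a small perturbation (line `gram-pencil-harmonic-chaos`, crux
`EmbeddedDrudeMourre.DrudeDissolution`, item stmt-AtomisticToContinuum-12593; `--supports` file,
closes nothing)

WHAT. Let `A`, `A'` be bounded self-adjoint operators on a real inner product space, `φ`, `φ'` unit
vectors with `Aφ = ‖A‖φ`, `A'φ' = ‖A'‖φ'`, `⟪φ, φ'⟫ ≥ 0`, and suppose `A` has a gap on `φ^⊥`: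
`‖Aw‖ ≤ θ‖w‖` for `w ⊥ φ`, `θ < ‖A‖`. If `d = ‖A - A'‖ ≤ (‖A‖ - θ)/2` then
`‖φ' - φ‖ ≤ 4d/(‖A‖ - θ)` and `A'` has the gap `θ + d + ‖A‖ · 4d/(‖A‖ - θ)` on `φ'^⊥`
(`top_eigenpair_perturbation`, registered sub-goal; `top_eigenpair_perturbation'` is the form with named
hypotheses).

WHY. Along the coupling ray `ε ↦ pinnedChain ω₂ (aε) (bε) 1` the transfer operators `𝒯_ε` of the
position marginal form an operator-norm continuous family of compact self-adjoint positivity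
improving operators on ONE space `L²(ρ₀)`; this lemma turns the Jentzsch gap of each `𝒯_ε`
(`IsPositivityImproving.exists_spectralGap`) into a gap bounded away from `‖𝒯_ε‖` UNIFORMLY on the
compact parameter set `[0, 1]`, and the top eigenvector into a continuous function of `ε` — the two
inputs of the uniform exponential mixing and of the continuity in `ε` of the finite-dimensional
marginals of the thermal states asked by stub G.

PROOF. Elementary Hilbert-space algebra: with `φ' = βφ + χ`, `χ ⊥ φ`, the `φ^⊥`-component of
`(A - A')φ' = Aφ' - ‖A'‖φ'` is `Aχ - ‖A'‖χ`, of norm `≥ (‖A'‖ - θ)‖χ‖`; hence `‖χ‖ ≤ 2d/(‖A‖ - θ)`,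
`β² + ‖χ‖² = 1`, `β ≥ 0` give `‖φ' - φ‖ ≤ 2‖χ‖`; finally for `w ⊥ φ'`,
`|⟪φ, w⟫| = |⟪φ - φ', w⟫| ≤ ‖φ - φ'‖‖w‖` and `‖A'w‖ ≤ ‖Aw‖ + d‖w‖`.
-/

noncomputable section

open scoped RealInnerProductSpace

namespace Summit.AtomisticToContinuum.FouriersLaw.Theorems.DrudeDissolution.GramPencilHarmonicChaos

section Abstract

variable {E : Type} [NormedAddCommGroup E] [InnerProductSpace ℝ E] [CompleteSpace E]

/-- A self-adjoint operator with `Aφ = λφ` preserves `φ^⊥`. [folklore] -/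
theorem inner_apply_eq_zero_of_inner_eq_zero {A : E →L[ℝ] E} (hA : IsSelfAdjoint A) {φ : E}
    {lam : ℝ} (hAφ : A φ = lam • φ) {w : E} (hw : ⟪φ, w⟫ = 0) : ⟪φ, A w⟫ = 0 := by
  rw [← hA.isSymmetric.apply_clm, hAφ, real_inner_smul_left, hw, mul_zero]

omit [CompleteSpace E] in
/-- With a gap `θ` on `φ^⊥` (`φ` a unit top eigenvector), `‖Aw‖ ≤ (|⟪φ, w⟫| ‖A‖ + θ‖w‖)` for
every `w`. [folklore] -/
theorem norm_apply_le_of_gap {A : E →L[ℝ] E} {φ : E} (hφ : ‖φ‖ = 1)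
    (hAφ : A φ = ‖A‖ • φ) {θ : ℝ} (hθ0 : 0 ≤ θ)
    (hgap : ∀ w : E, ⟪φ, w⟫ = 0 → ‖A w‖ ≤ θ * ‖w‖) (w : E) :
    ‖A w‖ ≤ |⟪φ, w⟫| * ‖A‖ + θ * ‖w‖ := by
  obtain ⟨hwo, hwn⟩ :=
    Literature.Analysis.OperatorTheory.inner_sub_inner_smul_eq_zero_and_norm_le hφ w
  have hdec : A w = (⟪φ, w⟫ * ‖A‖) • φ + A (w - ⟪φ, w⟫ • φ) := by
    have e : w = ⟪φ, w⟫ • φ + (w - ⟪φ, w⟫ • φ) := by abel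
    conv_lhs => rw [e]
    rw [map_add, map_smul, hAφ, smul_smul]
  rw [hdec]
  calc ‖(⟪φ, w⟫ * ‖A‖) • φ + A (w - ⟪φ, w⟫ • φ)‖
      ≤ ‖(⟪φ, w⟫ * ‖A‖) • φ‖ + ‖A (w - ⟪φ, w⟫ • φ)‖ := norm_add_le _ _
    _ ≤ |⟪φ, w⟫| * ‖A‖ + θ * ‖w - ⟪φ, w⟫ • φ‖ := by
        rw [norm_smul, hφ, mul_one, Real.norm_eq_abs, abs_mul, abs_norm]
        exact add_le_add le_rfl (hgap _ hwo)
    _ ≤ |⟪φ, w⟫| * ‖A‖ + θ * ‖w‖ := by gcongr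

/-- **Stability of the top eigenpair and of the gap under a small self-adjoint perturbation.**
`A`, `A'` self-adjoint, `φ`, `φ'` unit vectors, `Aφ = ‖A‖φ`, `A'φ' = ‖A'‖φ'`, `⟪φ, φ'⟫ ≥ 0`,
gap `‖Aw‖ ≤ θ‖w‖` on `φ^⊥` with `0 ≤ θ < ‖A‖`, and `2‖A - A'‖ ≤ ‖A‖ - θ`. Then
`‖φ' - φ‖ ≤ 4‖A - A'‖/(‖A‖ - θ)` and
`‖A'w‖ ≤ (θ + ‖A - A'‖ + ‖A‖ · 4‖A - A'‖/(‖A‖ - θ)) ‖w‖` for every `w ⊥ φ'`. [folklore] -/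
theorem top_eigenpair_perturbation' {A A' : E →L[ℝ] E} (hA : IsSelfAdjoint A)
    {φ φ' : E} (hφ : ‖φ‖ = 1) (hφ' : ‖φ'‖ = 1) (hAφ : A φ = ‖A‖ • φ)
    (hAφ' : A' φ' = ‖A'‖ • φ') {θ : ℝ} (hθ0 : 0 ≤ θ) (hθ : θ < ‖A‖)
    (hgap : ∀ w : E, ⟪φ, w⟫ = 0 → ‖A w‖ ≤ θ * ‖w‖) (hpos : 0 ≤ ⟪φ, φ'⟫)
    (hd : 2 * ‖A - A'‖ ≤ ‖A‖ - θ) :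
    ‖φ' - φ‖ ≤ 4 * ‖A - A'‖ / (‖A‖ - θ) ∧
      ∀ w : E, ⟪φ', w⟫ = 0 →
        ‖A' w‖ ≤ (θ + ‖A - A'‖ + ‖A‖ * (4 * ‖A - A'‖ / (‖A‖ - θ))) * ‖w‖ := by
  set d : ℝ := ‖A - A'‖ with hd_def
  set lam : ℝ := ‖A‖ with hlam_def
  set lam' : ℝ := ‖A'‖ with hlam'_def
  set β : ℝ := ⟪φ, φ'⟫ with hβ_def
  set χ : E := φ' - β • φ with hχ_def
  have hd0 : 0 ≤ d := norm_nonneg _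
  have hgapθ : 0 < lam - θ := sub_pos.2 hθ
  have hφφ : ⟪φ, φ⟫ = 1 := by rw [real_inner_self_eq_norm_sq, hφ, one_pow]
  -- `‖A'‖ ≥ ‖A‖ - d`
  have hlam' : lam - d ≤ lam' := by
    have := norm_sub_norm_le A A'
    linarith
  have hlam'0 : 0 ≤ lam' := norm_nonneg _
  -- `χ ⊥ φ` and `φ' = β φ + χ`
  have hχo : ⟪φ, χ⟫ = 0 :=
    (Literature.Analysis.OperatorTheory.inner_sub_inner_smul_eq_zero_and_norm_le hφ φ').1
  have hdec : φ' = β • φ + χ := by rw [hχ_def]; abel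
  -- the `φ^⊥`-component of `(A - A') φ'`
  set g : E := A φ' - lam' • φ' with hg_def
  have hg_norm : ‖g‖ ≤ d := by
    have e : g = (A - A') φ' := by
      rw [hg_def, sub_apply, hAφ']
    rw [e]
    calc ‖(A - A') φ'‖ ≤ ‖A - A'‖ * ‖φ'‖ := (A - A').le_opNorm φ'
      _ = d := by rw [hφ', mul_one]
  have hAχo : ⟪φ, A χ⟫ = 0 := inner_apply_eq_zero_of_inner_eq_zero hA hAφ hχo
  have hg_inner : ⟪φ, g⟫ = β * lam - lam' * β := by
    rw [hg_def, inner_sub_right, real_inner_smul_right, ← hβ_def]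
    have e1 : ⟪φ, A φ'⟫ = β * lam := by
      rw [hdec, map_add, map_smul, hAφ, smul_smul, inner_add_right, real_inner_smul_right, hφφ,
        hAχo]
      ring
    rw [e1]
  have hproj : g - ⟪φ, g⟫ • φ = A χ - lam' • χ := by
    rw [hg_inner, hg_def, hdec, map_add, map_smul, hAφ, smul_smul]
    module
  have hcomp : ‖A χ - lam' • χ‖ ≤ d := by
    rw [← hproj]
    exact (Literature.Analysis.OperatorTheory.inner_sub_inner_smul_eq_zero_and_norm_le hφ g).2.trans
      hg_norm
  -- `(‖A'‖ - θ) ‖χ‖ ≤ d`, hence `‖χ‖ (‖A‖ - θ) ≤ 2 d`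
  have hχ1 : (lam' - θ) * ‖χ‖ ≤ d := by
    have h1 : ‖lam' • χ‖ - ‖A χ‖ ≤ ‖lam' • χ - A χ‖ := norm_sub_norm_le _ _
    rw [← norm_neg (lam' • χ - A χ), neg_sub, norm_smul, Real.norm_of_nonneg hlam'0] at h1
    have h2 := hgap χ hχo
    nlinarith
  have hχ2 : ‖χ‖ * (lam - θ) ≤ 2 * d := by
    have h1 : (lam - θ) / 2 ≤ lam' - θ := by linarith
    have h2 : ‖χ‖ * ((lam - θ) / 2) ≤ ‖χ‖ * (lam' - θ) :=
      mul_le_mul_of_nonneg_left h1 (norm_nonneg _)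
    nlinarith
  -- `β² + ‖χ‖² = 1`, `0 ≤ β ≤ 1`, so `‖φ' - φ‖ ≤ 2 ‖χ‖`
  have hpyth : β ^ 2 + ‖χ‖ ^ 2 = 1 := by
    have h1 : ⟪β • φ, χ⟫ = 0 := by rw [real_inner_smul_left, hχo, mul_zero]
    have h2 := norm_add_sq_eq_norm_sq_add_norm_sq_real h1
    rw [← hdec, hφ', norm_smul, hφ, mul_one, Real.norm_eq_abs] at h2
    nlinarith [sq_abs β]
  have hβ1 : β ≤ 1 := by
    have := abs_real_inner_le_norm φ φ'
    rw [hφ, hφ', mul_one, ← hβ_def] at this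
    exact (le_abs_self β).trans this
  have hdiff : ‖φ' - φ‖ ≤ 2 * ‖χ‖ := by
    have h1 : φ' - φ = (β - 1) • φ + χ := by rw [hdec]; module
    have h2 : ⟪(β - 1) • φ, χ⟫ = 0 := by rw [real_inner_smul_left, hχo, mul_zero]
    have h3 := norm_add_sq_eq_norm_sq_add_norm_sq_real h2
    rw [← h1, norm_smul, hφ, mul_one, Real.norm_eq_abs] at h3
    have h4 : ‖φ' - φ‖ * ‖φ' - φ‖ ≤ (2 * ‖χ‖) * (2 * ‖χ‖) := by
      rw [h3]
      have h5 : |β - 1| * |β - 1| = (1 - β) ^ 2 := by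
        rw [abs_sub_comm, abs_mul_abs_self]; ring
      rw [h5]
      nlinarith [mul_nonneg hpos (sub_nonneg.2 hβ1), norm_nonneg χ]
    exact (mul_self_le_mul_self_iff (norm_nonneg _) (by positivity)).2 h4
  have hη : ‖φ' - φ‖ ≤ 4 * d / (lam - θ) := by
    rw [le_div_iff₀ hgapθ]
    nlinarith [hdiff, hχ2, norm_nonneg χ]
  refine ⟨hη, fun w hw => ?_⟩
  -- the gap of `A'` on `φ'^⊥`
  have hα : |⟪φ, w⟫| ≤ ‖φ' - φ‖ * ‖w‖ := by
    have e : ⟪φ, w⟫ = -⟪φ' - φ, w⟫ := by rw [inner_sub_left, hw, zero_sub, neg_neg]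
    rw [e, abs_neg]
    exact abs_real_inner_le_norm _ _
  have hAw : ‖A w‖ ≤ |⟪φ, w⟫| * lam + θ * ‖w‖ := norm_apply_le_of_gap hφ hAφ hθ0 hgap w
  have hA'w : ‖A' w‖ ≤ ‖A w‖ + d * ‖w‖ := by
    have e : A' w = A w - (A - A') w := by
      rw [sub_apply]; abel
    rw [e]
    calc ‖A w - (A - A') w‖ ≤ ‖A w‖ + ‖(A - A') w‖ := norm_sub_le _ _
      _ ≤ ‖A w‖ + d * ‖w‖ := add_le_add le_rfl ((A - A').le_opNorm w)
  have hlam0 : 0 ≤ lam := norm_nonneg _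
  have hw0 : 0 ≤ ‖w‖ := norm_nonneg _
  calc ‖A' w‖ ≤ ‖A w‖ + d * ‖w‖ := hA'w
    _ ≤ |⟪φ, w⟫| * lam + θ * ‖w‖ + d * ‖w‖ := by linarith
    _ ≤ ‖φ' - φ‖ * ‖w‖ * lam + θ * ‖w‖ + d * ‖w‖ := by
        gcongr
    _ ≤ 4 * d / (lam - θ) * ‖w‖ * lam + θ * ‖w‖ + d * ‖w‖ := by
        gcongr
    _ = (θ + d + lam * (4 * d / (lam - θ))) * ‖w‖ := by ring

/-- **Stability of the top eigenpair and of the gap under a small self-adjoint perturbation**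
(registered form of `top_eigenpair_perturbation'`, sub-goal of stub G). [folklore] -/
theorem top_eigenpair_perturbation : ∀ {E : Type} [NormedAddCommGroup E] [InnerProductSpace ℝ E]
    [CompleteSpace E] {A A' : E →L[ℝ] E}, IsSelfAdjoint A → ∀ {φ φ' : E}, ‖φ‖ = 1 → ‖φ'‖ = 1 →
    A φ = ‖A‖ • φ → A' φ' = ‖A'‖ • φ' → ∀ {θ : ℝ}, 0 ≤ θ → θ < ‖A‖ →
    (∀ w : E, inner ℝ φ w = 0 → ‖A w‖ ≤ θ * ‖w‖) → 0 ≤ inner ℝ φ φ' → 2 * ‖A - A'‖ ≤ ‖A‖ - θ →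
    ‖φ' - φ‖ ≤ 4 * ‖A - A'‖ / (‖A‖ - θ) ∧ ∀ w : E, inner ℝ φ' w = 0 →
    ‖A' w‖ ≤ (θ + ‖A - A'‖ + ‖A‖ * (4 * ‖A - A'‖ / (‖A‖ - θ))) * ‖w‖ :=
  @top_eigenpair_perturbation'

end Abstract

end Summit.AtomisticToContinuum.FouriersLaw.Theorems.DrudeDissolution.GramPencilHarmonicChaos

end
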